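import Literature.NumberTheory.GelbartRogawski1991.QuadExtSplittingCharArchComponents
import Literature.NumberTheory.Weil1964.ArchActQuadraticPlaces
import Literature.RepresentationTheory.CompactGroups.CircleCharacters
import Literature.Analysis.Complex.AngularPart
import HarnessLib

/-!
# The archimedean type of a global splitting character at a complex place FIXED by the involution (general `E/F`):
# `χ_w(z) = (z/|z|)^{e_w}` with `e_w` odd

Topic `NumberTheory/GelbartRogawski1991`; namespace `Literature.NumberTheory.GelbartRogawski1991.UnitaryDualPair.ArchSplitting.QuadExt`
(continues `QuadExtSplittingCharArchComponents`).  KERNEL only: proved theorems; no definition, no named fact, no `sorry`.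

For a quadratic extension `E/F` of number fields with non-trivial `F`-automorphism `c`, an element `δ` with `c δ = -δ ≠ 0`, and a
complex place `w` of `E` with `c • w = w` (type (i): the place `v = w|_F` is REAL and `w` is the ONLY place above it — `E_w = ℂ ⊋ F_v = ℝ`):

* §1 `isReal_comap_of_smul_eq` (`v` is real: `σ_w(F) ⊂ ℝ`), `embedding_lt_zero_of_smul_eq` (`σ_v(δ²) < 0`: `σ_w(δ)` is purely
  imaginary), `embedding_quadExtGenerator_lt_zero_of_smul_eq` (`σ_v(θ) < 0` for the generator `E = F(√θ)`, `θ = quadExtGenerator F E`,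
  since `δ² = θ t²`), `eq_of_comap_eq_of_smul_eq` (**uniqueness of the place over `v`**, Mathlib's count
  `#unramified + 2·#ramified = [E : F] = 2` over `v`);
* §2 for a Hecke character `χ` of `E` with `χ|_{𝕀_F} = ε_{E/F}` (`IsSplittingCharExt F E 1 χ`): `archComponent_toInfPlace_eq`
  (`χ_w(ι_w x) = ε_v(x) = sgn(σ_v x)` for `x ∈ F_vˣ` — one place over `v`, `ε_v = sgn` at a real place with `σ_v(θ) < 0`);
* §3 **`IsSplittingCharExt.exists_odd_archComponent_eq_unitPart_zpow`** — for `χ` moreover UNITARY there is an ODD integer `e_w` with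
  `χ_w(y) = (σ_w y/|σ_w y|)^{e_w}` for every `y ∈ E_wˣ` (`Complex.unitPart` = the angular part): the restriction of `χ_w` to
  `U(1) ⊂ ℂˣ = E_wˣ` is a continuous character of the circle, hence a power map (`CircleChar.eq_zpow`); `χ_w` is trivial on
  `ℝ_{>0} = σ_v(F_v)_{>0}` (`ε_v(x) = 1` for `σ_v x > 0`) and `ℂˣ = ℝ_{>0} · U(1)`; `χ_w(-1) = ε_v(-1) = -1` forces `e_w` odd.
  This is the `(e_w, 0)`-type of `CMSplittingCharArchComponents` / [Liu2021, Remark 4.2] WITHOUT the CM arch-type theory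
  (`IsSplittingChar.exists_hasUnitaryArchType`), valid at every `c`-fixed place of an arbitrary quadratic `E/F` — the input of
  the `det`-power twist `η_v = det(g_w)^{(e_w+1)/2}` at the places of type (i) of the general-`E/F` kernel construction of
  [GelbartRogawski1991, Prop. 3.1.1] when `F` is not totally real (then `E` is not CM).

## References

* [HarrisKudlaSweet1996] M. Harris, S. Kudla, W. Sweet, JAMS 9 (1996), §1 (1.5) p. 951.
* [Liu2021] Y. Liu, Camb. J. Math. 9 (2021), §4.1 Remark 4.2.
* [GelbartRogawski1991] S. Gelbart, J. Rogawski, Invent. Math. 105 (1991), §3.1 p. 456 (3.1.2), Remark p. 457.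
* [Paul1998] A. Paul, J. Funct. Anal. 159 (1998), §1.2 (1.2.1)–(1.2.2) p. 389.
* [BrockerTomDieck1985] T. Bröcker, T. tom Dieck, *Representations of Compact Lie Groups* (1985), Ch. II Prop. 8.1.
-/

set_option autoImplicit false

noncomputable section

open scoped NumberField Classical ComplexConjugate
open NumberField NumberField.InfinitePlace IsDedekindDomain

open _root_.Literature.NumberTheory.Automorphic _root_.Literature.NumberTheory.Automorphic.UnitaryGroup
open _root_.Literature.NumberTheory.GaloisRepresentations
open _root_.Literature.RepresentationTheory.HarrisKudlaSweet1996
open _root_.Literature.Analysis.Complex (unitPart ofRealUnits coe_unitPart unitPart_apply_of_norm_eq_one)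
open _root_.Literature.RepresentationTheory.CompactGroups

namespace Literature.NumberTheory.GelbartRogawski1991.UnitaryDualPair.ArchSplitting.QuadExt

variable (F : Type) [Field F] [NumberField F] (E : Type) [Field E] [NumberField E] [Algebra F E]
  [Algebra.IsQuadraticExtension F E] (c : E ≃ₐ[F] E) (w : {w : InfinitePlace E // w.IsComplex})

/-! ## §1 A complex place fixed by the involution: the place below is real, `σ_v(θ) < 0`, and `w` is the only place above it -/

section Place

omit [NumberField F] [NumberField E] [Algebra.IsQuadraticExtension F E] in
/-- **`v = w|_F` is real** when `c • w = w`, `c ≠ 1` (`σ_w ∘ (F → E)` is fixed by complex conjugation).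
[cite: GelbartRogawski1991, §3.1 p. 454] -/
theorem isReal_comap_of_smul_eq (hw : c • w.1 = w.1) (hc : c ≠ 1) : (w.1.comap (algebraMap F E)).IsReal := by
  refine ⟨w.1.embedding.comp (algebraMap F E), ?_, ?_⟩
  · rw [ComplexEmbedding.isReal_iff]
    ext t
    exact conj_embedding_algebraMap F E c w hw hc t
  · rw [← comap_mk, mk_embedding]

omit [NumberField F] [NumberField E] [Algebra.IsQuadraticExtension F E] in
/-- `σ_v(d) = σ_w(δ)² = -(im σ_w δ)² < 0` for `δ² = d`, `c δ = -δ ≠ 0`, at a `c`-fixed complex place (`σ_w δ` is purely imaginary).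
[cite: GelbartRogawski1991, §3.1 p. 454] -/
theorem embedding_lt_zero_of_smul_eq (hw : c • w.1 = w.1) (hc : c ≠ 1) {δ : E} (hcδ : c δ = -δ) (hδ : δ ≠ 0) {d : F}
    (hd : δ * δ = algebraMap F E d) :
    embedding_of_isReal (isReal_comap_of_smul_eq F E c w hw hc) d < 0 := by
  have hemb := Weil1964.embedding_comp_eq_of_isReal F E (w.1.comap (algebraMap F E)) (isReal_comap_of_smul_eq F E c w hw hc) ⟨w.1, rfl⟩
  have h1 : ((embedding_of_isReal (isReal_comap_of_smul_eq F E c w hw hc) d : ℝ) : ℂ) = w.1.embedding δ * w.1.embedding δ := by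
    rw [embedding_of_isReal_apply, ← hemb, RingHom.comp_apply, ← hd, map_mul]
  have hre := re_embedding_delta F E c w hw hc hcδ
  have him := im_embedding_delta_ne_zero F E c w hw hc hcδ hδ
  have h2 : embedding_of_isReal (isReal_comap_of_smul_eq F E c w hw hc) d = -((w.1.embedding δ).im ^ 2) := by
    have h3 := congrArg Complex.re h1
    rw [Complex.ofReal_re, Complex.mul_re, hre, zero_mul, zero_sub] at h3
    rw [h3, sq]
  rw [h2, neg_lt_zero]
  positivity

omit [NumberField E] in
/-- **`σ_v(θ) < 0`** for the generator `θ = quadExtGenerator F E` (`E = F(√θ)`) at the real place `v` below a `c`-fixed complex place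
(`δ² = θ t²` with `t ∈ Fˣ`, `exists_sq_eq_quadExtGenerator_mul_sq`). [cite: GelbartRogawski1991, §3.1 p. 454] -/
theorem embedding_quadExtGenerator_lt_zero_of_smul_eq [NumberField E] (hw : c • w.1 = w.1) (hc : c ≠ 1) {δ : E}
    (hcδ : c δ = -δ) (hδ : δ ≠ 0) :
    embedding_of_isReal (isReal_comap_of_smul_eq F E c w hw hc) ((quadExtGenerator F E : 𝓞 F) : F) < 0 := by
  obtain ⟨d, hd⟩ := exists_mul_self_eq_algebraMap E c hcδ hδ
  have hδF : ∀ r : F, algebraMap F E r ≠ δ := fun r hr =>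
    not_mem_range_algebraMap_of_apply_eq_neg E c hcδ hδ ⟨r, hr⟩
  obtain ⟨t, ht0, hdt⟩ := exists_sq_eq_quadExtGenerator_mul_sq (F := F) (E := E) hδF hd
  have hlt := embedding_lt_zero_of_smul_eq F E c w hw hc hcδ hδ hd
  rw [hdt, map_mul, map_pow] at hlt
  have ht : 0 < embedding_of_isReal (isReal_comap_of_smul_eq F E c w hw hc) t ^ 2 := by
    have hne : embedding_of_isReal (isReal_comap_of_smul_eq F E c w hw hc) t ≠ 0 :=
      (_root_.map_ne_zero _).2 ht0
    positivity
  by_contra hge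
  exact absurd hlt (not_lt.2 (mul_nonneg (not_lt.1 hge) ht.le))

/-- **the place over `v` is unique**: every infinite place `w'` of `E` over `v = w|_F` equals `w` (`w` is ramified over `F`, and
`#unramified + 2 · #ramified = [E : F] = 2` over `v`, Mathlib `unramifedPlacesOver_ncard_add_eq_finrank`).
[cite: GelbartRogawski1991, §3.1 p. 454] -/
theorem eq_of_comap_eq_of_smul_eq (hw : c • w.1 = w.1) (hc : c ≠ 1) (w' : InfinitePlace E)
    (h : w'.comap (algebraMap F E) = w.1.comap (algebraMap F E)) : w' = w.1 := by
  set v := w.1.comap (algebraMap F E) with hv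
  have hvr : v.IsReal := isReal_comap_of_smul_eq F E c w hw hc
  have hcount := unramifedPlacesOver_ncard_add_eq_finrank (K := F) (L := E) (v := v)
  rw [Algebra.IsQuadraticExtension.finrank_eq_two F E] at hcount
  have hwmem : w.1 ∈ ramifiedPlacesOver E v :=
    ⟨(mem_placesOver_iff E v w.1).2 rfl, isRamified_iff.2 ⟨w.2, hvr⟩⟩
  have hram1 : 0 < (ramifiedPlacesOver E v).ncard := (Set.ncard_pos (Set.toFinite _)).2 ⟨w.1, hwmem⟩
  have hram : (ramifiedPlacesOver E v).ncard = 1 := by omega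
  have hunr : (unramifiedPlacesOver E v).ncard = 0 := by omega
  have hunr' : unramifiedPlacesOver E v = ∅ := (Set.ncard_eq_zero (Set.toFinite _)).1 hunr
  obtain ⟨a, ha⟩ := Set.ncard_eq_one.1 hram
  have hw'mem : w' ∈ placesOver E v := (mem_placesOver_iff E v w').2 h
  rw [← union_ramifiedPlacesOver_unramifiedPlacesOver, hunr', Set.union_empty, ha, Set.mem_singleton_iff] at hw'mem
  rw [ha, Set.mem_singleton_iff] at hwmem
  rw [hw'mem, hwmem]

/-- the places over `v = w|_F` form the singleton `{w}`. [cite: GelbartRogawski1991, §3.1 p. 454] -/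
theorem univ_infPlacesOver_eq_of_smul_eq (hw : c • w.1 = w.1) (hc : c ≠ 1) :
    (Finset.univ : Finset (InfPlacesOver E (w.1.comap (algebraMap F E)))) = {⟨w.1, rfl⟩} := by
  ext w'
  simp only [Finset.mem_univ, Finset.mem_singleton, true_iff]
  exact Subtype.ext (eq_of_comap_eq_of_smul_eq F E c w hw hc w'.1 w'.2)

end Place

/-! ## §2 `χ_w(ι_w x) = ε_v(x) = sgn(σ_v x)` for `x ∈ F_vˣ` -/

section Restrict

variable {F E}

omit [NumberField E] in
/-- **`χ_w(ι_w x) = ε_{E/F,v}(x)`** for `χ|_{𝕀_F} = ε_{E/F}` and `x ∈ F_vˣ`, `v = w|_F` (one place over `v`).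
[cite: HarrisKudlaSweet1996, §1 (1.5) p. 951] -/
theorem archComponent_toInfPlace_eq [NumberField E] {χ : HeckeCharacter E} (hχ : IsSplittingCharExt F E 1 χ)
    (hw : c • w.1 = w.1) (hc : c ≠ 1) (x : ((w.1.comap (algebraMap F E)).Completion)ˣ) :
    χ.archComponent w.1 (Units.map (toInfPlace E (w.1.comap (algebraMap F E)) ⟨w.1, rfl⟩).toMonoidHom x) =
      quadraticHeckeCharExt F E (infiniteIdeleSingle (w.1.comap (algebraMap F E)) x) := by
  have h := hχ.prod_archComponent_placesOver (w.1.comap (algebraMap F E)) x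
  rw [univ_infPlacesOver_eq_of_smul_eq F E c w hw hc, Finset.prod_singleton, pow_one] at h
  exact h

omit [NumberField E] in
/-- **`χ_w(ι_w x) = sgn(σ_v x)`**: `= 1` iff `σ_v(x) > 0` (`ε_v = sgn` at the real place `v`, where `σ_v(θ) < 0`).
[cite: HarrisKudlaSweet1996, §1 (1.5) p. 951] -/
theorem archComponent_toInfPlace_eq_one_iff [NumberField E] {χ : HeckeCharacter E} (hχ : IsSplittingCharExt F E 1 χ)
    (hw : c • w.1 = w.1) (hc : c ≠ 1) {δ : E} (hcδ : c δ = -δ) (hδ : δ ≠ 0)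
    (x : ((w.1.comap (algebraMap F E)).Completion)ˣ) :
    χ.archComponent w.1 (Units.map (toInfPlace E (w.1.comap (algebraMap F E)) ⟨w.1, rfl⟩).toMonoidHom x) = 1 ↔
      0 < Completion.ringEquivRealOfIsReal (isReal_comap_of_smul_eq F E c w hw hc)
        (x : (w.1.comap (algebraMap F E)).Completion) := by
  rw [archComponent_toInfPlace_eq c w hχ hw hc, quadraticHeckeCharExt_def]
  exact quadraticHeckeChar_infiniteIdeleSingle_eq_one_iff_of_neg (not_isSquare_quadExtGenerator F E)
    (isReal_comap_of_smul_eq F E c w hw hc) (embedding_quadExtGenerator_lt_zero_of_smul_eq F E c w hw hc hcδ hδ) x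

end Restrict

/-! ## §3 The archimedean type `(e_w, 0)`, `e_w` odd -/

section ArchType

variable {F E}

omit [NumberField F] [Algebra.IsQuadraticExtension F E] in
/-- `x ↦ (x, 1) : (E ⊗ ℝ)ˣ → 𝕀_E` is continuous. [folklore] -/
private theorem continuous_infiniteIdeles' : Continuous (infiniteIdeles E) :=
  Continuous.units_map (MonoidHom.inl (InfiniteAdeleRing E) (FiniteAdeleRing (𝓞 E) E)) (continuous_id.prodMk continuous_const)

omit [NumberField F] [Algebra.IsQuadraticExtension F E] in
/-- the archimedean component `χ_w : E_wˣ → ℂˣ` is continuous. [cite: TateThesis1967, §4.3] -/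
theorem continuous_archComponent (χ : HeckeCharacter E) (w₀ : InfinitePlace E) : Continuous (χ.archComponent w₀) := by
  change Continuous fun y => χ (infiniteIdeleSingle w₀ y)
  refine χ.toContinuousMonoidHom.continuous.comp ?_
  change Continuous fun y : (w₀.Completion)ˣ => infiniteIdeles E
    (Units.map (MonoidHom.mulSingle (fun v : InfinitePlace E => v.Completion) w₀ : w₀.Completion →* InfiniteAdeleRing E) y)
  exact (continuous_infiniteIdeles' (E := E)).comp (Continuous.units_map _ (continuous_mulSingle w₀))

/-- `S¹ → ℂˣ` is continuous. [folklore] -/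
private theorem continuous_circle_toUnits : Continuous (Circle.toUnits : Circle → ℂˣ) := by
  have hval : Continuous fun z : Circle => ((z : Circle) : ℂ) := continuous_subtype_val
  refine Units.continuous_iff.2 ⟨?_, ?_⟩
  · have h : (Units.val ∘ ⇑Circle.toUnits : Circle → ℂ) = fun z : Circle => ((z : Circle) : ℂ) :=
      funext fun z => by rw [Function.comp_apply, Circle.toUnits_apply, Units.val_mk0]
    exact (show Continuous (Units.val ∘ ⇑Circle.toUnits : Circle → ℂ) from h ▸ hval)
  · have h : (fun z : Circle => (((Circle.toUnits z)⁻¹ : ℂˣ) : ℂ)) = fun z : Circle => (((z : Circle) : ℂ))⁻¹ :=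
      funext fun z => by rw [Units.val_inv_eq_inv_val, Circle.toUnits_apply, Units.val_mk0]
    exact (show Continuous (fun z : Circle => (((Circle.toUnits z)⁻¹ : ℂˣ) : ℂ)) from
      h ▸ hval.inv₀ fun z => z.coe_ne_zero)

omit [NumberField F] [Algebra.IsQuadraticExtension F E] in
/-- polar decomposition in `ℂˣ`: `u = ‖u‖ · (u/‖u‖)`. [folklore] -/
private theorem units_eq_ofRealUnits_mul_unitPart (u : ℂˣ) :
    u = ofRealUnits (Units.mk0 ‖(u : ℂ)‖ (norm_ne_zero_iff.2 u.ne_zero)) * Circle.toUnits (unitPart u) := by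
  apply Units.ext
  rw [Units.val_mul, Literature.Analysis.Complex.coe_ofRealUnits, Units.val_mk0, Circle.toUnits_apply, Units.val_mk0, coe_unitPart,
    mul_div_cancel₀ _ (by exact_mod_cast norm_ne_zero_iff.2 u.ne_zero)]

/-- **THE ARCHIMEDEAN TYPE AT A `c`-FIXED COMPLEX PLACE: `χ_w(y) = (σ_w y/|σ_w y|)^{e_w}` with `e_w` ODD** — for a UNITARY Hecke
character `χ` of `E` with `χ|_{𝕀_F} = ε_{E/F}` (`IsSplittingCharExt F E 1 χ`), a complex place `w` of `E` with `c • w = w` (`c ≠ 1`,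
`c δ = -δ ≠ 0`): there is an odd `e : ℤ` with `χ.archComponent w y = unitPart (σ_w y) ^ e` for all `y ∈ E_wˣ`.
(The circle part is a power map by `CircleChar.eq_zpow`; `χ_w` is trivial on the positive reals `σ_v(F_v)_{>0}` and equal to
`ε_v(-1) = -1` at `-1`.) [cite: Liu2021, Remark 4.2] [cite: Paul1998, §1.2 (1.2.1)–(1.2.2) p. 389] -/
theorem _root_.Literature.RepresentationTheory.HarrisKudlaSweet1996.IsSplittingCharExt.exists_odd_archComponent_eq_unitPart_zpow
    {χ : HeckeCharacter E} (hχu : χ.IsUnitary) (hχ : IsSplittingCharExt F E 1 χ)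
    (hw : c • w.1 = w.1) (hc : c ≠ 1) {δ : E} (hcδ : c δ = -δ) (hδ : δ ≠ 0) :
    ∃ e : ℤ, Odd e ∧ ∀ y : (w.1.Completion)ˣ,
      ((χ.archComponent w.1 y : ℂˣ) : ℂ) =
        ((unitPart (Units.map (Completion.extensionEmbedding w.1).toMonoidHom y) : Circle) : ℂ) ^ e := by
  -- notation: `v = w|_F` (real), `σ_w : E_w ≃ ℂ`, `ι_w : F_v → E_w`
  set v := w.1.comap (algebraMap F E) with hvdef
  have hv : v.IsReal := isReal_comap_of_smul_eq F E c w hw hc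
  set σw : w.1.Completion ≃+* ℂ := Completion.ringEquivComplexOfIsComplex w.2 with hσw
  set ιw : v.Completion →+* w.1.Completion := toInfPlace E v ⟨w.1, rfl⟩ with hιw
  -- `ψ = χ_w ∘ σ_w⁻¹ : ℂˣ →* ℂˣ`, continuous and unitary
  set ψ : ℂˣ →* ℂˣ := (χ.archComponent w.1).comp (Units.map σw.symm.toRingHom.toMonoidHom) with hψ
  have hψc : Continuous ψ :=
    (continuous_archComponent χ w.1).comp
      (Continuous.units_map _ (Completion.isometryEquivComplexOfIsComplex w.2).symm.continuous)
  have hψ1 : ∀ u : ℂˣ, ‖((ψ u : ℂˣ) : ℂ)‖ = 1 := fun u => hχu _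
  have hψy : ∀ y : (w.1.Completion)ˣ,
      ψ (Units.map (Completion.extensionEmbedding w.1).toMonoidHom y) = χ.archComponent w.1 y := by
    intro y
    change χ.archComponent w.1 _ = _
    congr 1
    apply Units.ext
    change σw.symm (Completion.extensionEmbedding w.1 (y : w.1.Completion)) = y
    rw [← Completion.ringEquivComplexOfIsComplex_apply w.2, RingEquiv.symm_apply_apply]
  -- the circle part is a power map
  set f : Circle →* Circle := unitPart.comp (ψ.comp Circle.toUnits) with hf
  have hfc : Continuous f :=
    Literature.Analysis.Complex.continuous_unitPart.comp (hψc.comp continuous_circle_toUnits)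
  obtain ⟨n, hn⟩ := CircleChar.eq_zpow f hfc
  have hcirc : ∀ z : Circle, ((ψ (Circle.toUnits z) : ℂˣ) : ℂ) = (z : ℂ) ^ n := by
    intro z
    have h1 := congrArg (fun t : Circle => (t : ℂ)) (hn z)
    simp only [hf, MonoidHom.comp_apply, Circle.coe_zpow] at h1
    rw [← h1, unitPart_apply_of_norm_eq_one _ (hψ1 _)]
  -- the positive reals: `ψ(r) = χ_w(ι_w x) = ε_v(x) = 1` for `r = σ_v x > 0`
  have hreal : ∀ x : (v.Completion)ˣ,
      Units.map (Completion.extensionEmbedding w.1).toMonoidHom (Units.map ιw.toMonoidHom x) =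
        ofRealUnits (Units.map (Completion.ringEquivRealOfIsReal hv).toRingHom.toMonoidHom x) := by
    intro x
    apply Units.ext
    change Completion.extensionEmbedding w.1 (ιw (x : v.Completion)) = ((Completion.ringEquivRealOfIsReal hv (x : v.Completion) : ℝ) : ℂ)
    rw [hιw, Weil1964.extensionEmbedding_toInfPlace_of_isReal F E v hv ⟨w.1, rfl⟩, Completion.ringEquivRealOfIsReal_apply]
  have hpos : ∀ r : ℝˣ, 0 < (r : ℝ) → ψ (ofRealUnits r) = 1 := by
    intro r hr
    set x : (v.Completion)ˣ := Units.map (Completion.ringEquivRealOfIsReal hv).symm.toRingHom.toMonoidHom r with hx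
    have hxr : Units.map (Completion.ringEquivRealOfIsReal hv).toRingHom.toMonoidHom x = r := by
      apply Units.ext
      change Completion.ringEquivRealOfIsReal hv ((Completion.ringEquivRealOfIsReal hv).symm (r : ℝ)) = r
      exact (Completion.ringEquivRealOfIsReal hv).apply_symm_apply _
    rw [← hxr, ← hreal x, hψy]
    refine (archComponent_toInfPlace_eq_one_iff c w hχ hw hc hcδ hδ x).2 ?_
    change 0 < Completion.ringEquivRealOfIsReal hv ((Completion.ringEquivRealOfIsReal hv).symm (r : ℝ))
    rwa [(Completion.ringEquivRealOfIsReal hv).apply_symm_apply]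
  -- assembly: `ψ u = (u/|u|)^n`
  have hψu : ∀ u : ℂˣ, ((ψ u : ℂˣ) : ℂ) = ((unitPart u : Circle) : ℂ) ^ n := by
    intro u
    conv_lhs => rw [units_eq_ofRealUnits_mul_unitPart u, map_mul, Units.val_mul]
    rw [hpos _ (by rw [Units.val_mk0]; exact norm_pos_iff.2 u.ne_zero), Units.val_one, one_mul, hcirc]
  refine ⟨n, ?_, fun y => by rw [← hψy, hψu]⟩
  -- oddness: at `-1 = σ_v(x₋)`, `χ_w(ι_w x₋) = ε_v(x₋) = -1 = (-1)^n`
  set xm : (v.Completion)ˣ := Units.map (Completion.ringEquivRealOfIsReal hv).symm.toRingHom.toMonoidHom (-1) with hxm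
  have hxm1 : Completion.ringEquivRealOfIsReal hv (xm : v.Completion) = -1 := by
    change Completion.ringEquivRealOfIsReal hv ((Completion.ringEquivRealOfIsReal hv).symm (-1 : ℝ)) = -1
    exact (Completion.ringEquivRealOfIsReal hv).apply_symm_apply _
  have hne : χ.archComponent w.1 (Units.map ιw.toMonoidHom xm) ≠ 1 := by
    rw [Ne, archComponent_toInfPlace_eq_one_iff c w hχ hw hc hcδ hδ xm, hxm1, not_lt]
    norm_num
  have hval : ((χ.archComponent w.1 (Units.map ιw.toMonoidHom xm) : ℂˣ) : ℂ) = (-1 : ℂ) ^ n := by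
    rw [← hψy, hψu, hreal xm]
    congr 1
    have hr : Units.map (Completion.ringEquivRealOfIsReal hv).toRingHom.toMonoidHom xm = -1 := by
      apply Units.ext
      exact hxm1
    rw [hr, Literature.Analysis.Complex.coe_unitPart_ofRealUnits_of_neg _ (by rw [Units.val_neg, Units.val_one]; norm_num)]
  -- `χ_w(ι_w x₋)² = 1` (it is `±1`: a value of `ε`), and it is `≠ 1`, so it is `-1`
  have hsq : ((χ.archComponent w.1 (Units.map ιw.toMonoidHom xm) : ℂˣ) : ℂ) = -1 := by
    have h2 := archComponent_toInfPlace_eq c w hχ hw hc xm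
    have hsq1 := quadraticHeckeCharExt_apply_sq (F := F) (E := E) (infiniteIdeleSingle v xm)
    rw [← h2] at hsq1
    have h3 : (((χ.archComponent w.1 (Units.map ιw.toMonoidHom xm)) : ℂˣ) : ℂ) *
        (((χ.archComponent w.1 (Units.map ιw.toMonoidHom xm)) : ℂˣ) : ℂ) = 1 := by
      rw [← sq, ← Units.val_pow_eq_pow_val, hsq1, Units.val_one]
    rcases mul_self_eq_one_iff.1 h3 with h1 | h1
    · exact absurd (Units.ext h1) hne
    · exact h1
  rcases Int.even_or_odd n with hev | hodd
  · exfalso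
    rw [hsq, hev.neg_one_zpow] at hval
    norm_num at hval
  · exact hodd

end ArchType

/-! ## §4 Appendix (GR-1 g94, for GR-2's `wOfR` datum): over a real place below a complex place there is exactly one place,
and it is `c`-fixed; for `E` totally complex every real place of `F` carries such a place -/

section TotallyComplex

/-- **uniqueness of the place over a real place below a complex one** (quadratic `E/F`): if `w` is complex, `v = w|_F` is real and
`w' ∣ v` then `w' = w` (`#unramified + 2 · #ramified = 2` over `v`, `w` ramified). [cite: GelbartRogawski1991, §3.1 p. 454] -/
theorem eq_of_comap_eq_of_isReal_comap (hv : (w.1.comap (algebraMap F E)).IsReal) (w' : InfinitePlace E)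
    (h : w'.comap (algebraMap F E) = w.1.comap (algebraMap F E)) : w' = w.1 := by
  set v := w.1.comap (algebraMap F E) with hvdef
  have hcount := unramifedPlacesOver_ncard_add_eq_finrank (K := F) (L := E) (v := v)
  rw [Algebra.IsQuadraticExtension.finrank_eq_two F E] at hcount
  have hwmem : w.1 ∈ ramifiedPlacesOver E v :=
    ⟨(mem_placesOver_iff E v w.1).2 rfl, isRamified_iff.2 ⟨w.2, hv⟩⟩
  have hram1 : 0 < (ramifiedPlacesOver E v).ncard := (Set.ncard_pos (Set.toFinite _)).2 ⟨w.1, hwmem⟩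
  have hram : (ramifiedPlacesOver E v).ncard = 1 := by omega
  have hunr : (unramifiedPlacesOver E v).ncard = 0 := by omega
  have hunr' : unramifiedPlacesOver E v = ∅ := (Set.ncard_eq_zero (Set.toFinite _)).1 hunr
  obtain ⟨a, ha⟩ := Set.ncard_eq_one.1 hram
  have hw'mem : w' ∈ placesOver E v := (mem_placesOver_iff E v w').2 h
  rw [← union_ramifiedPlacesOver_unramifiedPlacesOver, hunr', Set.union_empty, ha, Set.mem_singleton_iff] at hw'mem
  rw [ha, Set.mem_singleton_iff] at hwmem
  rw [hw'mem, hwmem]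

/-- **a complex place over a real place is fixed by every `F`-automorphism** (`c • w ∣ v` too, and the place over `v` is unique).
[cite: GelbartRogawski1991, §3.1 p. 454] -/
theorem smul_eq_of_isReal_comap (hv : (w.1.comap (algebraMap F E)).IsReal) : c • w.1 = w.1 := by
  refine eq_of_comap_eq_of_isReal_comap F E w hv (c • w.1) ?_
  rw [comap_smul]
  congr 1
  ext x
  exact c.symm.commutes x

/-- **`E` totally complex: over every real place `v` of `F` there is a complex place `w` of `E`, fixed by `c`** — the datum
`wOfR` (with `hw`, `hover`) of the archimedean Weil half over an arbitrary base field `F`; it is unique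
(`eq_of_comap_eq_of_isReal_comap`). [cite: GelbartRogawski1991, §3.1 p. 454] -/
theorem exists_isComplex_smul_eq_comap_eq [IsTotallyComplex E] (v : {v : InfinitePlace F // v.IsReal}) :
    ∃ w : {w : InfinitePlace E // w.IsComplex}, c • w.1 = w.1 ∧ w.1.comap (algebraMap F E) = v.1 := by
  haveI : FiniteDimensional F E := Module.finite_of_finrank_eq_succ (Algebra.IsQuadraticExtension.finrank_eq_two F E)
  obtain ⟨w₀, hw₀⟩ := InfinitePlace.comap_surjective (k := F) (K := E) v.1
  have hw₀' : w₀.comap (algebraMap F E) = v.1 := hw₀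
  refine ⟨⟨w₀, IsTotallyComplex.isComplex w₀⟩, smul_eq_of_isReal_comap F E c ⟨w₀, IsTotallyComplex.isComplex w₀⟩ ?_, hw₀'⟩
  change (w₀.comap (algebraMap F E)).IsReal
  rw [hw₀']
  exact v.2

end TotallyComplex

end Literature.NumberTheory.GelbartRogawski1991.UnitaryDualPair.ArchSplitting.QuadExt

end
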